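import Literature.MathematicalPhysics.QuantumFieldTheory.Balaban1983to89.B8Eq178AveragesRec
import Literature.MathematicalPhysics.QuantumFieldTheory.Balaban1983to89.B8Eq119TwistedAxialRec

/-!
# `Balaban1983to89.B8BlockConstantLiftRec` — [Balaban1985Averaging] (78)–(80) ∕ [Balaban1985RegularSpaces] (1.29) FOR THE RECORD's CENTRED BLOCKING: a gauge transformation
# CONSTANT on the fine block tower under a level-`j` site has `R̄₀`-average equal to that constant at every level up to `j` («(1.29) WITH DATA»), and for every family of
# pairwise tower-disjoint cells every cell datum is realised by such a block-constant gauge transformation — item (B′-1) of the plan's road (B′) for director-ym №310's branch (ii)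

statement-level skeleton of published theorems with citation tags; proofs where landed; nothing here is a claim about the Yang–Mills mass gap

CITATION HEADER (lean-in-tree rule).  Cell `pub-ymgap` (HUMAN RULING D-0062), «N05-REC» road; director-ym №310 branch (ii) «Landau-restoring correction»; KILL-CHECK fired on road (A)
(n05-e 2026-08-29T20:36Z, desk memo `SCOPE-IIB.md`); plan g93 ■ re-presentation 20:37Z: ROAD-INDEPENDENT GO for (B′-1) «block-constant-lift realisation of cell data on the record tower»
and (B′-2) «stability of the axial surface under such lifts» — THIS FILE is (B′-1).  Pen dag-n05-e g41.  [3] = [Balaban1985Averaging] (78)–(81) p. 30; [6] = [Balaban1985RegularSpaces]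
(1.29) p. 81, (1.14)–(1.15) p. 78, (1.19) p. 79, (1.135)–(1.138) p. 99; [I] = [Balaban1987RG1] (0.3) p. 252.  `--kind proof --supports stmt-QuantumFields-20541` (K0⁷; count-neutral; no def).
REUSED BY NAME: `B7Eq78Linearization.{Rbar, Rbar_zero, Rbar_succ, avgStep, avgStep_eq_mul_exp_sum, conjR_apply}` ((78)–(80) generic), `B7SectEFLinearisationRec.{zdBlockingZ, bgTZ,
blockSitesZ, mem_blockSitesZ}` + `B8Eq178AveragesRec.smul_mem_blockSitesZ` (the record's centred blocking), `B8Eq119TwistedAxialRec.{UnderZ, underZ_zero_iff, underZ_one_block,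
underZ_one_centre, underZ_succ_of_underZ_block, bgTZ_one, Restr129Z}` (the centred block tower; (1.29) typed), `MatrixLog.mlog_one`.

WHY (road (B′), memo `SCOPE-IIB.md` §4).  Theorem 4's input must stay on the RADIAL axial surface; the only gauge changes that keep an axial tower axial are those CONSTANT on the
block towers under the cells (block-constant lifts); pre-composing the Thm-4 input by such a `g_c` carrying prescribed cell data `X` and post-composing the output `u₀` gives
`u′ = u₀·g_c` with rows 1–8 of `HThm4RecSym152` EXACT and restriction data `data(g_c) + O(|λ₀|·|∇g_c|)`.  This file supplies `g_c` and its EXACT data: (1.29)'s averages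
`R̄₀ʲ` ((79)–(80), the record's `Rbar (zdBlockingZ d L) (bgTZ L 1)`) of a transformation constant `= X` under the level-`j` site `y` equal `X` at `y` — at the trivial background
every (78)-step of a constant family is that constant.
WHAT IS PROVED (sorry-free).  §1 `avgStep_const_of_trivial` ((78) of a constant family with trivial transporters); §2 ★★ `rbar_one_eq_const_of_under` (odd `L`: `g = X` on
`{x : x ∈ Bʲ(y)}` ⇒ `R̄₀ʲ g (y) = X`); §3 ★★ `rbar_one_eq_data_of_blockConstant` — «(1.29) WITH DATA»: `g` constant `= X(j,y)` under every cell `(j,y)`, `j ≤ k` ⇒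
`Rbar … j g y = X(j,y)` on the cells (data `X ≡ 1` is `Restr129Z … 1 g`, `restr129Z_of_blockConstant_one`); §4 ★★ `exists_blockConstant_of_disjoint` — for every family of cells whose
block towers are pairwise disjoint and every datum `X`, a gauge transformation constant `= X(j,y)` under each cell, `= 1` off the towers, with values in `{1} ∪ range X`.
HONEST SCOPE.  Finite bookkeeping of (78)–(80) at the trivial background; NO estimate of Bałaban's; the surface-stability half (B′-2) and the `prop6_of_thm4` twin (B′-3) are separate
files; `HThm4Rec*` CONDITIONAL; N05 DISCHARGED OF RECORD since R467 (count-neutral record-level work), N07 NOT discharged; counts unmoved (typed 28∕28 · discharged 8∕28); one finite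
𝕋⁴ programme at fixed ε, `G = SU(2)` of record — nothing continuum ∕ ℝ⁴ ∕ OS ∕ mass gap ∕ Clay.  No `def`, no `instance`, no `notation`, no `sorry`.
-/

set_option autoImplicit false

noncomputable section

open scoped BigOperators

namespace Literature.MathematicalPhysics.QuantumFieldTheory.Balaban1983to89.B8BlockConstantLiftRec

open NormedSpace
open B7Prop1Explicit hiding Site
open B7Prop1Explicit renaming Site → SiteZ
open MatrixLog (mlog mlog_one)
open B7Eq78Linearization (Rbar Rbar_zero Rbar_succ avgStep avgStep_eq_mul_exp_sum conjR conjR_apply)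
open B7SectEFLinearisationRec (zdBlockingZ bgTZ blockSitesZ mem_blockSitesZ)
open BlockAveragingZd (offZ)
open B8Eq178AveragesRec (smul_mem_blockSitesZ)
open B8Eq119TwistedAxialRec (UnderZ underZ_zero_iff underZ_one_block underZ_one_centre underZ_succ_of_underZ_block bgTZ_one Restr129Z)

variable {d : ℕ}
variable {𝔸 : Type*} [NormedRing 𝔸] [NormOneClass 𝔸] [NormedAlgebra ℂ 𝔸] [CompleteSpace 𝔸]

/-! ## §1  One (78)-step of a constant family with trivial transporters -/

omit [NormOneClass 𝔸] [CompleteSpace 𝔸] in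
/-- **(78) of a CONSTANT family at the trivial background**: with transporters `T_x = 1` on the block, base value `X` and site values `v(x) = X` on the block,
`(R̄₀v)(y) = X·exp[Σ_x wt_x·log(X⁻¹·X)] = X`. [cite: Balaban1985Averaging, (78) p.30] -/
theorem avgStep_const_of_trivial {ι : Type*} (t : Finset ι) (wt : ι → ℝ) {T : ι → 𝔸ˣ} (hT : ∀ x ∈ t, T x = 1) (X : 𝔸ˣ)
    {v : ι → 𝔸} (hv : ∀ x ∈ t, v x = X) : avgStep t wt T (X : 𝔸) v = X := by
  rw [avgStep_eq_mul_exp_sum, Finset.sum_eq_zero, exp_zero, mul_one]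
  intro x hx
  rw [hv x hx, hT x hx, conjR_apply, Units.val_one, inv_one, Units.val_one, one_mul, mul_one, Ring.inverse_unit,
    Units.inv_mul, mlog_one, smul_zero]

/-! ## §2  `R̄₀ʲ` of a transformation constant on the block tower under `y` -/

omit [NormOneClass 𝔸] in
/-- ★★ **A GAUGE TRANSFORMATION CONSTANT ON THE BLOCK TOWER UNDER A LEVEL-`j` SITE HAS `R̄₀ʲ`-AVERAGE EQUAL TO THAT CONSTANT** ([3] (79)–(80) for the record's centred blocking
`zdBlockingZ`, trivial background; odd `L`): if `g(x) = X` for every fine site `x ∈ Bʲ(y)` (`UnderZ L j y x`), then `Rbar (zdBlockingZ d L) (bgTZ L 1) j g y = X` — by induction on `j`: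
the level-`j` sites of the centred block `B(y)` and its centre `L·y` lie one level under `y` (`underZ_one_block ∕ _centre`), their towers lie under `y`
(`underZ_succ_of_underZ_block`), so all their `R̄₀ʲ`-values are `X` and the (78)-step of §1 returns `X`. [cite: Balaban1985Averaging, (78)–(80) p.30; Balaban1985RegularSpaces, (1.29) p.81, (1.19) p.79; Balaban1987RG1, (0.3) p.252] -/
theorem rbar_one_eq_const_of_under {L : ℕ} (hL : Odd L) (g : SiteZ d → 𝔸ˣ) (X : 𝔸ˣ) :
    ∀ (j : ℕ) (y : SiteZ d), (∀ x, UnderZ L j y x → g x = X) →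
      Rbar (zdBlockingZ d L) (bgTZ L (1 : SiteZ d → Fin d → 𝔸ˣ)) j (fun x => ((g x : 𝔸ˣ) : 𝔸)) y = X
  | 0, y, h => by
    rw [Rbar_zero]
    exact congrArg (fun u : 𝔸ˣ => (u : 𝔸)) (h y ((underZ_zero_iff L y y).2 rfl))
  | j + 1, y, h => by
    obtain ⟨s, hs⟩ := hL
    have hLs : L = 2 * s + 1 := hs
    have hL1 : 1 ≤ L := by omega
    have IH : ∀ x ∈ blockSitesZ L y,
        Rbar (zdBlockingZ d L) (bgTZ L (1 : SiteZ d → Fin d → 𝔸ˣ)) j (fun x => ((g x : 𝔸ˣ) : 𝔸)) x = X := by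
      intro x hx
      obtain ⟨r, rfl⟩ := mem_blockSitesZ.1 hx
      exact rbar_one_eq_const_of_under ⟨s, hs⟩ g X j _ fun z hz =>
        h z (underZ_succ_of_underZ_block ⟨s, hs⟩ (underZ_one_block hLs y r) hz)
    rw [Rbar_succ]
    show avgStep (blockSitesZ L y) (fun _ => ((L : ℝ) ^ d)⁻¹) (bgTZ L (1 : SiteZ d → Fin d → 𝔸ˣ) j y)
        (Rbar (zdBlockingZ d L) (bgTZ L (1 : SiteZ d → Fin d → 𝔸ˣ)) j (fun x => ((g x : 𝔸ˣ) : 𝔸)) ((L : ℤ) • y))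
        (Rbar (zdBlockingZ d L) (bgTZ L (1 : SiteZ d → Fin d → 𝔸ˣ)) j (fun x => ((g x : 𝔸ˣ) : 𝔸))) = X
    rw [IH _ (smul_mem_blockSitesZ hL1 y)]
    refine avgStep_const_of_trivial _ _ (fun x _ => ?_) X IH
    rw [bgTZ_one]

/-! ## §3  «(1.29) WITH DATA» for a family of cells -/

omit [NormOneClass 𝔸] in
/-- ★★ **(1.29) WITH DATA**: if `g` is constant `= X(j, y)` on the block tower under every cell `y ∈ Λ_j`, `j ≤ k`, then its `R̄₀`-averages read the data:
`Rbar (zdBlockingZ d L) (bgTZ L 1) j g y = X(j, y)` for all `j ≤ k`, `y ∈ Λ_j` (odd `L`). [cite: Balaban1985RegularSpaces, (1.29) p.81; Balaban1985Averaging, (79)–(80) p.30] -/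
theorem rbar_one_eq_data_of_blockConstant {L : ℕ} (hL : Odd L) (k : ℕ) (Λ : ℕ → Set (SiteZ d)) (X : ℕ → SiteZ d → 𝔸ˣ) (g : SiteZ d → 𝔸ˣ)
    (hg : ∀ j, j ≤ k → ∀ y ∈ Λ j, ∀ x, UnderZ L j y x → g x = X j y) :
    ∀ j, j ≤ k → ∀ y ∈ Λ j, Rbar (zdBlockingZ d L) (bgTZ L (1 : SiteZ d → Fin d → 𝔸ˣ)) j (fun x => ((g x : 𝔸ˣ) : 𝔸)) y = X j y :=
  fun j hj y hy => rbar_one_eq_const_of_under hL g (X j y) j y (hg j hj y hy)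

omit [NormOneClass 𝔸] in
/-- The data `X ≡ 1` case: a transformation equal to `1` on the block tower under every cell satisfies (1.29) — `Restr129Z L k Λ 1 g`. [cite: Balaban1985RegularSpaces, (1.29) p.81, (1.14) p.78] -/
theorem restr129Z_of_blockConstant_one {L : ℕ} (hL : Odd L) (k : ℕ) (Λ : ℕ → Set (SiteZ d)) (g : SiteZ d → 𝔸ˣ)
    (hg : ∀ j, j ≤ k → ∀ y ∈ Λ j, ∀ x, UnderZ L j y x → g x = 1) :
    Restr129Z L k Λ (1 : SiteZ d → Fin d → 𝔸ˣ) g := by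
  intro j hj y hy
  have h := rbar_one_eq_data_of_blockConstant hL k Λ (fun _ _ => (1 : 𝔸ˣ)) g hg j hj y hy
  rw [h, Units.val_one]

/-! ## §4  Realising a cell datum by a block-constant transformation (pairwise tower-disjoint cells) -/

/-- ★★ **EVERY CELL DATUM IS REALISED BY A BLOCK-CONSTANT GAUGE TRANSFORMATION** when the block towers under the cells `(j, y)`, `j ≤ k`, `y ∈ Λ_j`, are pairwise disjoint
(the tower structure of [6] (1.5)–(1.6) ∕ [15] (148): every fine site lies under at most one cell): for every datum `X`, there is `g` with `g = X(j, y)` on the tower under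
`(j, y)`, `g = 1` off the towers, and every value of `g` is `1` or some `X(j, y)` (so `g` is `G`-valued when the data are).  With §3 its (1.29)-averages ARE the data.
[cite: Balaban1985RegularSpaces, (1.5)–(1.6) p.77, (1.29) p.81; Balaban1985Variational, (148) p.301; Balaban1987RG1, (0.3) p.252] -/
theorem exists_blockConstant_of_disjoint {G : Type*} [Group G] (L k : ℕ) (Λ : ℕ → Set (SiteZ d)) (X : ℕ → SiteZ d → G)
    (hdisj : ∀ j, j ≤ k → ∀ j', j' ≤ k → ∀ y ∈ Λ j, ∀ y' ∈ Λ j', ∀ x, UnderZ L j y x → UnderZ L j' y' x → j = j' ∧ y = y') :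
    ∃ g : SiteZ d → G,
      (∀ j, j ≤ k → ∀ y ∈ Λ j, ∀ x, UnderZ L j y x → g x = X j y) ∧
      (∀ x, (¬ ∃ j, j ≤ k ∧ ∃ y ∈ Λ j, UnderZ L j y x) → g x = 1) ∧
      (∀ x, g x = 1 ∨ ∃ j, j ≤ k ∧ ∃ y ∈ Λ j, g x = X j y) := by
  classical
  let P : SiteZ d → Prop := fun x => ∃ j, j ≤ k ∧ ∃ y ∈ Λ j, UnderZ L j y x
  let g : SiteZ d → G := fun x =>
    if h : P x then X (Classical.choose h) (Classical.choose (Classical.choose_spec h).2) else 1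
  refine ⟨g, ?_, ?_, ?_⟩
  · intro j hj y hy x hx
    have hP : P x := ⟨j, hj, y, hy, hx⟩
    have hg : g x = X (Classical.choose hP) (Classical.choose (Classical.choose_spec hP).2) := by
      simp only [g, dif_pos hP]
    rw [hg]
    obtain ⟨hj', hrest⟩ := Classical.choose_spec hP
    obtain ⟨hy', hx'⟩ := Classical.choose_spec hrest
    obtain ⟨hjj, hyy⟩ := hdisj _ hj' j hj _ hy' y hy x hx' hx
    exact congrArg₂ X hjj hyy
  · intro x hx
    have hP : ¬ P x := hx
    simp only [g, dif_neg hP]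
  · intro x
    by_cases hP : P x
    · right
      obtain ⟨hj', hrest⟩ := Classical.choose_spec hP
      obtain ⟨hy', -⟩ := Classical.choose_spec hrest
      exact ⟨_, hj', _, hy', by simp only [g, dif_pos hP]⟩
    · left
      simp only [g, dif_neg hP]

end Literature.MathematicalPhysics.QuantumFieldTheory.Balaban1983to89.B8BlockConstantLiftRec
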